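import Literature.MathematicalPhysics.QuantumLattice.FermionGammaFunctorTrace
import Literature.MathematicalPhysics.QuantumLattice.FreeFermionTraceFormulaProofs
import Literature.MathematicalPhysics.QuantumLattice.HubbardRingPerronFrobeniusProofs
import Literature.MathematicalPhysics.QuantumLattice.FreeFermionSectorEnergyDeviation
import Literature.MathematicalPhysics.QuantumLattice.MagneticHubbardTorusGauge

/-!
# The free-fermion sector floor of a general spin-independent quadratic Hamiltonian

Infrastructure for the `U = 0` calibration of the tube cruxes 16311/16312/18509/18510: the
`U = 0` negatives (`WidthUniformThermodynamics/Negative/ZeroCouplingCompressibility`,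
`Cruxes/PerWidthThermodynamics/Disproof.lean` §(a')) and the strategist census of
`PerWidthThermodynamics` (§Transfer) all stop at the free floor of the RECTANGULAR / TWISTED tube —
the tree's Fermi-sea machinery (`FreeFermionSectorGroundStates`, `ReducedBCSTorus`) only knows the
plane waves of the hypercubic torus `FermionTorus d L`. This file proves the floor for an ARBITRARY
spin-independent quadratic Hamiltonian, basis-free, through the second-quantisation functor `Γ`:

* `Gamma_conjTranspose_mul_dGamma_mul_Gamma` — `Γ(V)ᴴ dΓ(h) Γ(V) = dΓ(Vᴴ h V)` for unitary `V`
  (from the tree's `e^{dΓ(K)} dΓ(A) e^{-dΓ(K)} = dΓ(e^K A e^{-K})` and `e^{dΓ(K)} = Γ(e^K)`);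
* `preservesSectors_of_commute`, `commute_Gamma_sum_numberOp`, `preservesSectors_Gamma` — a
  spin-diagonal unitary `V` has a sector-preserving implementer `Γ(V)` (it commutes with
  `N_σ = dΓ(1_σ)`), so conjugation by `Γ(V)` leaves the sector energies invariant
  (`Matrix.minEnergyOn_conjTranspose_mul_mul`);
* `minEnergyOn_diagonal_szSector_eq` — the sector minimum of a diagonal Fock matrix; the Fermi-set
  rearrangement on configurations (`sum_fermiSet_le_sum`, `two_mul_sum_fermiSet_le_sum_config`);
* **`minEnergyOn_dGamma_szSector_eq_of_conj` / `_of_eigen`** — for `Vᴴ H V = diag(ev ∘ site)`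
  (resp. `VᴴV = 1`, `HV = V·diag`) and a Fermi set `F` of `ev`:
  `(dGamma H).minEnergyOn (szSector (2 #F) 0) = 2 Σ_{x∈F} ev x`;
* `isGroundStateInSector_Gamma_mulVec_single` — the Slater determinant `Γ(V)|F↑ ∪ F↓⟩` is a sector
  ground state.

Sources: Bardeen–Cooper–Schrieffer, Phys. Rev. 108 (1957) 1175, §II; Bratteli–Robinson II (1997)
§5.2.1–5.2.2; Lieb–Loss, *Analysis* (2001) Thm 1.14; Tasaki (2020) §2.2, §9.2. Folklore
finite-dimensional statements; no definitions, no named facts. REUSED: `Gamma*`,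
`exp_dGamma_eq_Gamma_exp`, `exists_exp_eq_coe_unitaryGroup`, `exp_dGamma_mul_dGamma_mul_exp_neg`,
`dGamma_diagonal_eq_diagonal`, `numberAt_eq_diagonal`, `PreservesSectors`, `pairSet`,
`mem_szSector_two_mul_zero_iff`, `sum_fermiSet_le`, `Matrix.minEnergyOn_conjTranspose_mul_mul`;
`lean search 'minEnergyOn_dGamma|preservesSectors_of_commute|sum_pairSet'`: nothing (2026-08-17).
-/

noncomputable section

namespace Summit.HubbardSuperconductivity.HubbardSuperconductivity.Theorems.WidthHaldane

set_option linter.dupNamespace false -- summit = problem name (single-conjunct summit), D-0017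

open scoped BigOperators Classical Matrix ComplexConjugate
open Matrix Finset NormedSpace Literature.MathematicalPhysics.QuantumLattice Literature.Probability.LatticeModels

/-! ### Bogoliubov covariance of `dΓ` under `Γ` of a unitary -/

section GammaConj

variable {ι : Type*} [LinearOrder ι] [Fintype ι]

/-- **Bogoliubov covariance of `dΓ` under `Γ` of a unitary**: `Γ(V)ᴴ dΓ(h) Γ(V) = dΓ(Vᴴ h V)`
(`Vᴴ = e^{K}`, `Γ(e^{K}) = e^{dΓ(K)}`, and `e^{dΓ(K)} dΓ(h) e^{-dΓ(K)} = dΓ(e^{K} h e^{-K})`).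
Bratteli–Robinson II §5.2.1 (`Γ(U) dΓ(A) Γ(U)* = dΓ(UAU*)`). [cite: BratteliRobinsonII1997, §5.2.1] -/
theorem Gamma_conjTranspose_mul_dGamma_mul_Gamma {V : Matrix ι ι ℂ} (hV : V ∈ Matrix.unitaryGroup ι ℂ)
    (h : Matrix ι ι ℂ) :
    (Gamma V)ᴴ * dGamma h * Gamma V = dGamma (Vᴴ * h * V) := by
  have hVV : Vᴴ * V = 1 := by
    have := Matrix.mem_unitaryGroup_iff'.1 hV
    simpa [Matrix.star_eq_conjTranspose] using this
  have hVV' : V * Vᴴ = 1 := by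
    have := Matrix.mem_unitaryGroup_iff.1 hV
    simpa [Matrix.star_eq_conjTranspose] using this
  have hV' : Vᴴ ∈ Matrix.unitaryGroup ι ℂ := by
    rw [Matrix.mem_unitaryGroup_iff, Matrix.star_eq_conjTranspose, conjTranspose_conjTranspose]
    exact hVV
  obtain ⟨K, hK⟩ := exists_exp_eq_coe_unitaryGroup ⟨Vᴴ, hV'⟩
  simp only at hK
  have hneg : exp (-K) = V := by
    rw [Matrix.exp_neg, hK]
    exact Matrix.inv_eq_left_inv hVV'
  have hdneg : -dGamma K = dGamma (-K) := by
    rw [← neg_one_smul ℂ K, dGamma_smul, neg_one_smul]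
  have h1 := exp_dGamma_mul_dGamma_mul_exp_neg K h 1
  rw [one_smul, one_smul, hdneg, exp_dGamma_eq_Gamma_exp, exp_dGamma_eq_Gamma_exp, hneg, hK,
    Gamma_conjTranspose] at h1
  exact h1

end GammaConj


/-! ### Spin-resolved particle numbers; block-diagonality from commutation -/

section Sectors

variable {Λ : Type*} [LinearOrder Λ] [Fintype Λ]

/-- The spin-`σ` particle number `N_σ = Σ_x n_{xσ}` is diagonal in the occupation basis, with
eigenvalue the number of spin-`σ` orbitals of the configuration. Tasaki (2020) §9.2. [folklore] -/
theorem sum_numberOp_eq_diagonal (σ : Fin 2) :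
    (∑ x : Λ, numberOp x σ : Matrix (Finset (Orb Λ)) (Finset (Orb Λ)) ℂ) =
      diagonal fun s => (((univ.filter fun x : Λ => orb x σ ∈ s).card : ℕ) : ℂ) := by
  have h : ∀ x : Λ, (numberOp x σ : Matrix (Finset (Orb Λ)) (Finset (Orb Λ)) ℂ) =
      diagonal fun s => if orb x σ ∈ s then (1 : ℂ) else 0 := fun x => numberAt_eq_diagonal (orb x σ)
  simp_rw [h]
  ext s t
  simp only [Matrix.sum_apply, diagonal_apply]
  by_cases hst : s = t
  · subst hst
    simp only [if_true]
    rw [Finset.sum_boole]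
  · simp [hst]

/-- `N_σ` is the second quantisation of the spin-`σ` indicator: `dΓ(1_{σ}) = Σ_x n_{xσ}`.
Bratteli–Robinson II §5.2.1. [folklore] -/
theorem dGamma_spinIndicator (σ : Fin 2) :
    dGamma (diagonal fun o : Orb Λ => if (ofLex o).2 = σ then (1 : ℂ) else 0) =
      ∑ x : Λ, numberOp x σ := by
  rw [dGamma_diagonal]
  have hre : ∀ f : Orb Λ → Matrix (Finset (Orb Λ)) (Finset (Orb Λ)) ℂ,
      ∑ o, f o = ∑ x : Λ, ∑ τ : Fin 2, f (orb x τ) := fun f => by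
    rw [← Fintype.sum_prod_type', ← (toLex : Λ × Fin 2 ≃ Orb Λ).sum_comp]
  rw [hre]
  refine Finset.sum_congr rfl fun x _ => ?_
  simp only [orb, ofLex_toLex, ite_smul, one_smul, zero_smul, Finset.sum_ite_eq', Finset.mem_univ,
    if_true]
  rfl

/-- **Block-diagonality from conservation laws**: a Fock matrix commuting with `N_↑` and `N_↓`
preserves the sectors `(N_↑, N_↓)` (converse of `PreservesSectors.commute_diagonal`). [folklore] -/
theorem preservesSectors_of_commute {A : Matrix (Finset (Orb Λ)) (Finset (Orb Λ)) ℂ}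
    (h0 : Commute A (∑ x : Λ, numberOp x 0)) (h1 : Commute A (∑ x : Λ, numberOp x 1)) :
    PreservesSectors A := by
  rw [sum_numberOp_eq_diagonal 0] at h0
  rw [sum_numberOp_eq_diagonal 1] at h1
  intro s s' hA
  have e0 := congrFun (congrFun h0.eq s) s'
  have e1 := congrFun (congrFun h1.eq s) s'
  rw [mul_diagonal, diagonal_mul] at e0 e1
  -- `e0 : A s s' * ↑#up(s') = ↑#up(s) * A s s'`, similarly `e1`
  rw [mul_comm (A s s')] at e0 e1
  constructor
  · have : ((upPart s').card : ℂ) = (upPart s).card := mul_right_cancel₀ hA e0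
    exact_mod_cast this.symm
  · have : ((downPart s').card : ℂ) = (downPart s).card := mul_right_cancel₀ hA e1
    exact_mod_cast this.symm

/-- For a SPIN-DIAGONAL unitary one-body `V` (`V_{oo'} = 0` when `o, o'` carry different spins) the
implementer `Γ(V)` commutes with `N_↑`, `N_↓` (`Γ(V)ᴴ dΓ(1_σ) Γ(V) = dΓ(Vᴴ 1_σ V) = dΓ(1_σ)`). [folklore] -/
theorem commute_Gamma_sum_numberOp {V : Matrix (Orb Λ) (Orb Λ) ℂ} (hV : V ∈ Matrix.unitaryGroup (Orb Λ) ℂ)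
    (hspin : ∀ o o' : Orb Λ, (ofLex o).2 ≠ (ofLex o').2 → V o o' = 0) (σ : Fin 2) :
    Commute (Gamma V) (∑ x : Λ, numberOp x σ) := by
  set P : Matrix (Orb Λ) (Orb Λ) ℂ := diagonal fun o : Orb Λ => if (ofLex o).2 = σ then (1 : ℂ) else 0
    with hP
  have hVV : Vᴴ * V = 1 := by
    have := Matrix.mem_unitaryGroup_iff'.1 hV
    simpa [Matrix.star_eq_conjTranspose] using this
  -- `V` commutes with the spin indicator
  have hPV : P * V = V * P := by
    ext o o'
    rw [hP, diagonal_mul, mul_diagonal]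
    by_cases h : (ofLex o).2 = (ofLex o').2
    · rw [h, mul_comm]
    · rw [hspin o o' h, mul_zero, zero_mul]
  have hconj : Vᴴ * P * V = P := by
    rw [Matrix.mul_assoc, hPV, ← Matrix.mul_assoc, hVV, Matrix.one_mul]
  have hG := Gamma_conjTranspose_mul_dGamma_mul_Gamma hV P
  rw [hconj, dGamma_spinIndicator] at hG
  -- `Γ(V)ᴴ N_σ Γ(V) = N_σ` and `Γ(V)` unitary give the commutation
  have hU := Gamma_mem_unitaryGroup hV
  have hGG : Gamma V * (Gamma V)ᴴ = 1 := by
    have := Matrix.mem_unitaryGroup_iff.1 hU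
    simpa [Matrix.star_eq_conjTranspose] using this
  rw [Commute, SemiconjBy]
  calc Gamma V * ∑ x : Λ, numberOp x σ
      = Gamma V * ((Gamma V)ᴴ * (∑ x : Λ, numberOp x σ) * Gamma V) := by rw [hG]
    _ = Gamma V * (Gamma V)ᴴ * (∑ x : Λ, numberOp x σ) * Gamma V := by noncomm_ring
    _ = (∑ x : Λ, numberOp x σ) * Gamma V := by rw [hGG, Matrix.one_mul]

/-- `Γ(V)` preserves the sectors `(N_↑, N_↓)` for a spin-diagonal unitary `V`. [folklore] -/
theorem preservesSectors_Gamma {V : Matrix (Orb Λ) (Orb Λ) ℂ} (hV : V ∈ Matrix.unitaryGroup (Orb Λ) ℂ)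
    (hspin : ∀ o o' : Orb Λ, (ofLex o).2 ≠ (ofLex o').2 → V o o' = 0) :
    PreservesSectors (Gamma V) :=
  preservesSectors_of_commute (commute_Gamma_sum_numberOp hV hspin 0)
    (commute_Gamma_sum_numberOp hV hspin 1)

/-- `Γ(V)ᴴ = Γ(Vᴴ)` preserves the sectors `(N_↑, N_↓)` for a spin-diagonal unitary `V`. [folklore] -/
theorem preservesSectors_Gamma_conjTranspose {V : Matrix (Orb Λ) (Orb Λ) ℂ}
    (hV : V ∈ Matrix.unitaryGroup (Orb Λ) ℂ)
    (hspin : ∀ o o' : Orb Λ, (ofLex o).2 ≠ (ofLex o').2 → V o o' = 0) :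
    PreservesSectors (Gamma V)ᴴ := by
  rw [← Gamma_conjTranspose]
  refine preservesSectors_Gamma (V := Vᴴ) (by rw [← Matrix.star_eq_conjTranspose]; exact Unitary.star_mem hV)
    fun o o' h => ?_
  rw [conjTranspose_apply, hspin o' o (Ne.symm h), star_zero]

/-- A sector-preserving matrix maps the joint sector `(2n, S^z = 0)` into itself. [folklore] -/
theorem mulVec_mem_szSector_of_preservesSectors {A : Matrix (Finset (Orb Λ)) (Finset (Orb Λ)) ℂ}
    (hA : PreservesSectors A) {n : ℕ} {ψ : Fock (Orb Λ)} (hψ : ψ ∈ szSector (2 * n) 0) :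
    A *ᵥ ψ ∈ szSector (2 * n) 0 := by
  rw [mem_szSector_two_mul_zero_iff] at hψ ⊢
  exact hA.isInSector_mulVec hψ

end Sectors

/-! ### The diagonal case: the sector minimum of a diagonal matrix -/

section Diagonal

variable {Λ : Type*} [LinearOrder Λ] [Fintype Λ]

/-- **Sector minimum of a diagonal matrix**: for a real diagonal Fock matrix `diag w` and a
configuration `s₀` of the `(n, n)` sector minimising `w` there, the lowest variational energy on
`szSector (2n) 0` is `w s₀` (attained at `|s₀⟩`; `⟨ψ, diag w ψ⟩ = Σ_s w_s |ψ_s|² ≥ w_{s₀}`). [folklore] -/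
theorem minEnergyOn_diagonal_szSector_eq (w : Finset (Orb Λ) → ℝ) (n : ℕ) (s₀ : Finset (Orb Λ))
    (hs₀ : (upPart s₀).card = n ∧ (downPart s₀).card = n)
    (hmin : ∀ s : Finset (Orb Λ), (upPart s).card = n ∧ (downPart s).card = n → w s₀ ≤ w s) :
    (diagonal fun s => ((w s : ℝ) : ℂ)).minEnergyOn (szSector (2 * n) 0) = w s₀ := by
  unfold Matrix.minEnergyOn
  -- the quadratic form of the diagonal matrix
  have hform : ∀ ψ : Fock (Orb Λ),
      (star ψ ⬝ᵥ (diagonal fun s => ((w s : ℝ) : ℂ)) *ᵥ ψ).re = ∑ s, w s * Complex.normSq (ψ s) := by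
    intro ψ
    rw [dotProduct, Complex.re_sum]
    refine Finset.sum_congr rfl fun s _ => ?_
    rw [mulVec_diagonal, Pi.star_apply, Complex.star_def, mul_left_comm,
      ← Complex.normSq_eq_conj_mul_self, ← Complex.ofReal_mul, Complex.ofReal_re]
  have hnorm : ∀ ψ : Fock (Orb Λ), star ψ ⬝ᵥ ψ = 1 → ∑ s, Complex.normSq (ψ s) = 1 := by
    intro ψ h1
    have h := congrArg Complex.re h1
    rw [dotProduct, Complex.re_sum, Complex.one_re] at h
    rw [← h]
    refine Finset.sum_congr rfl fun s _ => ?_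
    rw [Pi.star_apply, Complex.star_def, ← Complex.normSq_eq_conj_mul_self, Complex.ofReal_re]
  refine IsLeast.csInf_eq ⟨?_, ?_⟩
  · -- attained at the basis vector `|s₀⟩`
    refine ⟨Pi.single s₀ 1, ?_, ?_, ?_⟩
    · rw [mem_szSector_two_mul_zero_iff]
      intro s hs
      have hne : s ≠ s₀ := fun h => hs (h ▸ hs₀)
      simp [hne]
    · simp [dotProduct, Pi.single_apply]
    · rw [hform]
      simp [Pi.single_apply, apply_ite Complex.normSq]
  · -- lower bound on the sector
    rintro E ⟨ψ, hmem, h1, rfl⟩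
    rw [hform]
    rw [mem_szSector_two_mul_zero_iff] at hmem
    calc w s₀ = ∑ s, w s₀ * Complex.normSq (ψ s) := by rw [← Finset.mul_sum, hnorm ψ h1, mul_one]
      _ ≤ ∑ s, w s * Complex.normSq (ψ s) := by
        refine Finset.sum_le_sum fun s _ => ?_
        by_cases hs : (upPart s).card = n ∧ (downPart s).card = n
        · exact mul_le_mul_of_nonneg_right (hmin s hs) (Complex.normSq_nonneg _)
        · rw [hmem s hs, map_zero, mul_zero, mul_zero]

/-- A sum over the configuration `α↑ ∪ α'↓` splits into its up and down parts. [folklore] -/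
theorem sum_pairSet {β : Type*} [AddCommMonoid β] (α α' : Finset Λ) (f : Orb Λ → β) :
    ∑ o ∈ pairSet α α', f o = ∑ x ∈ α, f (orb x 0) + ∑ x ∈ α', f (orb x 1) := by
  rw [pairSet_eq_union_map, Finset.sum_union, Finset.sum_map, Finset.sum_map]
  · rfl
  · rw [Finset.disjoint_left]
    intro i hi hi'
    simp only [Finset.mem_map, Function.Embedding.coeFn_mk] at hi hi'
    obtain ⟨x, -, rfl⟩ := hi
    obtain ⟨y, -, hy⟩ := hi'
    simpa using congrArg (fun i => (ofLex i).2) hy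

/-- **The Fermi set minimises the sum of `n` levels** (set form of the bathtub bound `sum_fermiSet_le`):
`ev ≤ μ` on `F`, `μ ≤ ev` off `F`, `#T = #F` ⇒ `Σ_F ev ≤ Σ_T ev`. Lieb–Loss Thm 1.14. [folklore] -/
theorem sum_fermiSet_le_sum (ev : Λ → ℝ) (F : Finset Λ) (μ : ℝ) (hF : ∀ x ∈ F, ev x ≤ μ)
    (hF' : ∀ x ∉ F, μ ≤ ev x) (T : Finset Λ) (hT : T.card = F.card) :
    ∑ x ∈ F, ev x ≤ ∑ x ∈ T, ev x := by
  have h := sum_fermiSet_le ev (fun x => if x ∈ T then (1 : ℝ) else 0) F μ hF hF'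
    (fun x => by positivity) (fun x => by split_ifs <;> norm_num)
    (by rw [Finset.sum_boole, Finset.filter_mem_eq_inter, Finset.univ_inter, hT])
  simpa [Finset.sum_ite_mem, Finset.univ_inter] using h

/-- On the `(n, n)` sector the spin-independent one-body weight of a configuration is at least twice
the Fermi sum: `2 Σ_F ev ≤ Σ_{(x,σ) ∈ s} ev x` when `#up(s) = #down(s) = #F`. [folklore] -/
theorem two_mul_sum_fermiSet_le_sum_config (ev : Λ → ℝ) (F : Finset Λ) (μ : ℝ)
    (hF : ∀ x ∈ F, ev x ≤ μ) (hF' : ∀ x ∉ F, μ ≤ ev x) (s : Finset (Orb Λ))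
    (hs : (upPart s).card = F.card ∧ (downPart s).card = F.card) :
    2 * ∑ x ∈ F, ev x ≤ ∑ o ∈ s, ev (ofLex o).1 := by
  rw [← pairSet_upPart_downPart s, sum_pairSet]
  have h1 := sum_fermiSet_le_sum ev F μ hF hF' (upPart s) hs.1
  have h2 := sum_fermiSet_le_sum ev F μ hF hF' (downPart s) hs.2
  simp only [orb, ofLex_toLex]
  linarith

/-- The paired Fermi sea `F↑ ∪ F↓` has weight `2 Σ_F ev`. [folklore] -/
theorem sum_pairSet_self (ev : Λ → ℝ) (F : Finset Λ) :
    ∑ o ∈ pairSet F F, ev (ofLex o).1 = 2 * ∑ x ∈ F, ev x := by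
  rw [sum_pairSet]
  simp only [orb, ofLex_toLex]
  ring

end Diagonal

/-! ### The free-fermion sector floor -/

section Floor

variable {Λ : Type*} [LinearOrder Λ] [Fintype Λ]

/-- **The free-fermion sector floor (general quadratic Hamiltonian).** If the one-body matrix `H`
on `Orb Λ` is diagonalised by a spin-diagonal unitary `V` with SPIN-INDEPENDENT spectrum,
`Vᴴ H V = diag (ev ∘ site)`, and `F ⊆ Λ` is a Fermi set of `ev` (`ev ≤ μ` on `F`, `μ ≤ ev` off `F`),
then the lowest energy of `dΓ(H)` in the sector `(N, S^z) = (2#F, 0)` is `2 Σ_{x∈F} ev x` (conjugate by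
`Γ(V)` to `dΓ(diag) = diag (s ↦ Σ_{o∈s} ev o)`, minimised at the paired Fermi sea `F↑ ∪ F↓`).
Bardeen–Cooper–Schrieffer (1957) §II; Lieb–Loss Thm 1.14; Bratteli–Robinson II §5.2. [folklore] -/
theorem minEnergyOn_dGamma_szSector_eq_of_conj (H V : Matrix (Orb Λ) (Orb Λ) ℂ)
    (hV : V ∈ Matrix.unitaryGroup (Orb Λ) ℂ)
    (hspin : ∀ o o' : Orb Λ, (ofLex o).2 ≠ (ofLex o').2 → V o o' = 0) (ev : Λ → ℝ)
    (hdiag : Vᴴ * H * V = diagonal fun o => ((ev (ofLex o).1 : ℝ) : ℂ))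
    (F : Finset Λ) (μ : ℝ) (hF : ∀ x ∈ F, ev x ≤ μ) (hF' : ∀ x ∉ F, μ ≤ ev x) :
    (dGamma H).minEnergyOn (szSector (2 * F.card) 0) = 2 * ∑ x ∈ F, ev x := by
  have hW := Gamma_mem_unitaryGroup hV
  have hWW : (Gamma V)ᴴ * Gamma V = 1 := by
    have := Matrix.mem_unitaryGroup_iff'.1 hW
    simpa [Matrix.star_eq_conjTranspose] using this
  have hWW' : Gamma V * (Gamma V)ᴴ = 1 := by
    have := Matrix.mem_unitaryGroup_iff.1 hW
    simpa [Matrix.star_eq_conjTranspose] using this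
  have hpres := preservesSectors_Gamma hV hspin
  have hpres' := preservesSectors_Gamma_conjTranspose hV hspin
  rw [← Matrix.minEnergyOn_conjTranspose_mul_mul (dGamma H) (Gamma V) (szSector (2 * F.card) 0) hWW hWW'
      (fun ψ hψ => mulVec_mem_szSector_of_preservesSectors hpres hψ)
      (fun ψ hψ => mulVec_mem_szSector_of_preservesSectors hpres' hψ),
    Gamma_conjTranspose_mul_dGamma_mul_Gamma hV, hdiag, dGamma_diagonal_eq_diagonal]
  have hw : (fun s : Finset (Orb Λ) => ∑ i ∈ s, ((ev (ofLex i).1 : ℝ) : ℂ)) =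
      fun s => (((∑ i ∈ s, ev (ofLex i).1 : ℝ)) : ℂ) := by
    funext s
    push_cast
    rfl
  rw [hw, minEnergyOn_diagonal_szSector_eq (fun s => ∑ i ∈ s, ev (ofLex i).1) F.card (pairSet F F)
      ⟨by rw [upPart_pairSet], by rw [downPart_pairSet]⟩
      (fun s hs => by
        rw [sum_pairSet_self]
        exact two_mul_sum_fermiSet_le_sum_config ev F μ hF hF' s hs),
    sum_pairSet_self]

/-- **The free-fermion sector floor, eigenvector form**: the same conclusion from `Vᴴ V = 1` and the
column eigenvector equations `H V = V diag (ev ∘ site)`. [folklore] -/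
theorem minEnergyOn_dGamma_szSector_eq_of_eigen (H V : Matrix (Orb Λ) (Orb Λ) ℂ)
    (hVV : Vᴴ * V = 1)
    (hspin : ∀ o o' : Orb Λ, (ofLex o).2 ≠ (ofLex o').2 → V o o' = 0) (ev : Λ → ℝ)
    (heig : H * V = V * diagonal fun o => ((ev (ofLex o).1 : ℝ) : ℂ))
    (F : Finset Λ) (μ : ℝ) (hF : ∀ x ∈ F, ev x ≤ μ) (hF' : ∀ x ∉ F, μ ≤ ev x) :
    (dGamma H).minEnergyOn (szSector (2 * F.card) 0) = 2 * ∑ x ∈ F, ev x := by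
  have hV : V ∈ Matrix.unitaryGroup (Orb Λ) ℂ := by
    rw [Matrix.mem_unitaryGroup_iff']
    simpa [Matrix.star_eq_conjTranspose] using hVV
  refine minEnergyOn_dGamma_szSector_eq_of_conj H V hV hspin ev ?_ F μ hF hF'
  rw [Matrix.mul_assoc, heig, ← Matrix.mul_assoc, hVV, Matrix.one_mul]

/-- `dΓ(H) Γ(V) = Γ(V) dΓ(D)` when `Vᴴ H V = D` (`V` unitary). [folklore] -/
theorem dGamma_mul_Gamma_of_conj {H V : Matrix (Orb Λ) (Orb Λ) ℂ} (hV : V ∈ Matrix.unitaryGroup (Orb Λ) ℂ)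
    {D : Matrix (Orb Λ) (Orb Λ) ℂ} (hdiag : Vᴴ * H * V = D) :
    dGamma H * Gamma V = Gamma V * dGamma D := by
  have hW := Gamma_mem_unitaryGroup hV
  have hWW' : Gamma V * (Gamma V)ᴴ = 1 := by
    have := Matrix.mem_unitaryGroup_iff.1 hW
    simpa [Matrix.star_eq_conjTranspose] using this
  rw [← hdiag, ← Gamma_conjTranspose_mul_dGamma_mul_Gamma hV H, ← Matrix.mul_assoc, ← Matrix.mul_assoc,
    hWW', Matrix.one_mul]

/-- **The Slater determinant over a Fermi set is a sector ground state**: under the hypotheses of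
`minEnergyOn_dGamma_szSector_eq_of_conj`, `Γ(V) |F↑ ∪ F↓⟩` (the paired Fermi sea of the modes = columns
of `V`) is a ground state of `dΓ(H)` in the sector `(2#F, S^z = 0)`. BCS (1957) §II. [folklore] -/
theorem isGroundStateInSector_Gamma_mulVec_single (H V : Matrix (Orb Λ) (Orb Λ) ℂ)
    (hV : V ∈ Matrix.unitaryGroup (Orb Λ) ℂ)
    (hspin : ∀ o o' : Orb Λ, (ofLex o).2 ≠ (ofLex o').2 → V o o' = 0) (ev : Λ → ℝ)
    (hdiag : Vᴴ * H * V = diagonal fun o => ((ev (ofLex o).1 : ℝ) : ℂ))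
    (F : Finset Λ) (μ : ℝ) (hF : ∀ x ∈ F, ev x ≤ μ) (hF' : ∀ x ∉ F, μ ≤ ev x) :
    IsGroundStateInSector (dGamma H) (2 * F.card) 0 (Gamma V *ᵥ Pi.single (pairSet F F) 1) := by
  have hW := Gamma_mem_unitaryGroup hV
  have hWW : (Gamma V)ᴴ * Gamma V = 1 := by
    have := Matrix.mem_unitaryGroup_iff'.1 hW
    simpa [Matrix.star_eq_conjTranspose] using this
  refine ⟨?_, ?_, ?_⟩
  · refine mulVec_mem_szSector_of_preservesSectors (preservesSectors_Gamma hV hspin) ?_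
    rw [mem_szSector_two_mul_zero_iff]
    intro s hs
    have hne : s ≠ pairSet F F := fun h => hs (by rw [h, upPart_pairSet, downPart_pairSet]; exact ⟨rfl, rfl⟩)
    simp [hne]
  · intro h0
    have h := congrArg (fun v => (Gamma V)ᴴ *ᵥ v) h0
    simp only [mulVec_mulVec, hWW, one_mulVec, mulVec_zero] at h
    exact one_ne_zero (α := ℂ) (by simpa using congrFun h (pairSet F F))
  · have hsum : (∑ i ∈ pairSet F F, ((ev (ofLex i).1 : ℝ) : ℂ)) = (((2 * ∑ x ∈ F, ev x : ℝ)) : ℂ) := by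
      rw [← sum_pairSet_self]
      push_cast
      rfl
    rw [minEnergyOn_dGamma_szSector_eq_of_conj H V hV hspin ev hdiag F μ hF hF', mulVec_mulVec,
      dGamma_mul_Gamma_of_conj hV hdiag, ← mulVec_mulVec, dGamma_diagonal_eq_diagonal,
      Matrix.diagonal_mulVec_single, mul_one, hsum, ← Matrix.mulVec_smul]
    congr 1
    ext t
    simp [Pi.single_apply]

end Floor

end Summit.HubbardSuperconductivity.HubbardSuperconductivity.Theorems.WidthHaldane

end
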